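import Summits.RiemannHypothesis.RiemannHypothesis.Theorems.HandoffDodgerProfileControl
import Summits.RiemannHypothesis.RiemannHypothesis.Theorems.HandoffDodgerCountingCumulants
import Summits.RiemannHypothesis.RiemannHypothesis.Theorems.HandoffDodgerCountingMajorant
import Summits.RiemannHypothesis.RiemannHypothesis.Theorems.HandoffDodgerProfileBoundMajorant
import HarnessLib

/-!
# HANDOFF — PROFILE CONTROL on the collar under the COUNTING cumulant bound `‖S_j‖ ≤ j·A·V^j` (rh-explicit, W-P(P2) crux 19185, seat dodger-p2 gen0; DODGER-STAGE2-PLAN §2 (c) brick B3-iii-b)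

RH-FREE. HONEST FRAMING: nothing here bears on the truth of RH; the twin of gen10's `HandoffDodgerProfileControl.re_dodger_edge_sub_ge`
(ATTEMPT-16 Lemma D1 assembled) with the GEOMETRIC cumulant bound replaced by an abstract bound `‖S_j‖ ≤ j·A·V^j` (`j ≥ 2`), which
`HandoffDodgerCountingCumulants.norm_dodgerPowerSum_le_counting` supplies with `V = T₀²`, `A = T₀/(25π) + s/2 + (T+¼)K/W`
(`norm_dodgerPowerSum_le_AV` below; ATTEMPT-16 Lemma B3: `κ = 1/(25π) + ν`). With `p = p₁ = Re S_1`, `g(m) = A(Vm/p)²/(1 − Vm/p)`: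
(1) `|b_m − p^m/m!| ≤ (p^m/m!)(e^{g(m)} − 1)` for `V·m < p` (`abs_profileCoeff_sub_le_counting`);
(2) `|b_m| ≤ e^{p/(2V) + A/2}·(2V)^m` for all `m` (`abs_profileCoeff_le_counting`, the tail at `u = 1/(2V)`);
(3) **`re_dodger_edge_sub_ge_counting`**: for `0 ≤ σ ≤ 2δ ≤ 2b`, `(1 − η − 3τ₁ − τ₂)·(c_∞/2b)·Φ(p₁σ²) ≤ Re F₀(b−σ)` whenever
`V·N₂ < p`, `η ≥ e^{g(N₁)} − 1`, `λ ≥ AV²N₂/(p²(1 − VN₂/p))`, `ρ₁ ≥ e^{3+λ}X/(4(N₁+1)³)`, `ρ₂ ≥ e²V(2δ)²/(2(N₂+1)²)`, `ρ₁, ρ₂ < 1`,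
`τ₁ ≥ ρ₁^{N₁+1}/(1−ρ₁)`, `τ₂ ≥ e^{p/(2V)+A/2}ρ₂^{N₂+1}/(1−ρ₂)` — via `profile_lower_bound_of_majorant`. The η-exponent is
`≈ 10N₁²/T′` instead of gen10's `≈ 56.6N₁²/T′` (MODEL floor of the explicit chain ≈ 950 instead of ≈ 7 000, DODGER-STAGE2-PLAN §2 (c)).
No `sorry`, standard axioms, no definitions.

References: this track (ATTEMPT-16 §3 Lemma B3, §5 Lemma D1; ATTEMPT-19 §5; HOME/rh-explicit-dodger-p2/DODGER-STAGE2-PLAN.md §2).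
-/

set_option linter.dupNamespace false

noncomputable section

open Complex Finset
open scoped Real

namespace Summit.RiemannHypothesis.RiemannHypothesis.Theorems.Handoff

open Literature.NumberTheory.LFunctions Literature.NumberTheory.LFunctions.SchoenfeldBound

/-! ## The counting cumulant bound in the form `‖S_j‖ ≤ j·A·V^j` -/

/-- **`‖S_j‖ ≤ j·A·V^j` for `j ≥ 2`** with `V = T₀²`, `A = T₀/(25π) + s/2 + (T+¼)K/W` (`W = T²+¼ ≤ T₀²`), from the counting bound
`‖S_j‖ ≤ j·T₀^{2j+1}/(π(2j+1)²) + s·T^{2j} + j·W^{j−1}(T+¼)K`. [this track, ATTEMPT-16 §3 Lemma B3 (SIZE: `κ = 1/(25π) + ν`)] -/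
theorem norm_dodgerPowerSum_le_AV {b T T₀ s : ℝ} (hb : 0 < b) (hT : 0 ≤ T) (hK : π * (zetaZeroCount T) / b ≤ T)
    (hΔ : ∀ t ∈ Set.Icc 0 T, (zetaZeroCount t : ℝ) - ((min ⌊b * t / π⌋₊ (zetaZeroCount T) : ℕ) : ℝ) ≤ 0)
    (hT₀ : 0 < T₀) (hTT₀ : T ≤ T₀) (hWV : T ^ 2 + 1 / 4 ≤ T₀ ^ 2) (hs : 0 ≤ s)
    (hcount : ∀ t ∈ Set.Icc 0 T, ((min ⌊b * t / π⌋₊ (zetaZeroCount T) : ℕ) : ℝ) - (zetaZeroCount t : ℝ) ≤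
      t / (2 * π) * Real.log (T₀ / t) + s)
    {j : ℕ} (hj : 2 ≤ j) :
    ‖dodgerPowerSum b T j‖ ≤
      (j : ℝ) * (T₀ / (25 * π) + s / 2 + (T + 1 / 4) * (zetaZeroCount T : ℝ) / (T ^ 2 + 1 / 4)) * (T₀ ^ 2) ^ j := by
  have h := norm_dodgerPowerSum_le_counting hb hT hK hΔ hT₀ hTT₀ hcount (show 1 ≤ j by omega)
  refine h.trans ?_
  have hπ := Real.pi_pos
  set W : ℝ := T ^ 2 + 1 / 4 with hW
  set V : ℝ := T₀ ^ 2 with hV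
  have hW0 : 0 < W := by positivity
  have hV0 : 0 < V := by positivity
  have hWVj : W ^ j ≤ V ^ j := pow_le_pow_left₀ hW0.le hWV j
  have hj2 : (2 : ℝ) ≤ j := by exact_mod_cast hj
  have hK0 : (0 : ℝ) ≤ zetaZeroCount T := Nat.cast_nonneg _
  -- term 1: `j T₀^{2j+1}/(π(2j+1)²) ≤ j V^j · T₀/(25π)`
  have h1 : (j : ℝ) * T₀ ^ (2 * j + 1) / (π * (2 * (j : ℝ) + 1) ^ 2) ≤ (j : ℝ) * (T₀ / (25 * π)) * V ^ j := by
    have e : T₀ ^ (2 * j + 1) = T₀ * V ^ j := by rw [hV, ← pow_mul, pow_succ]; ring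
    rw [e, div_le_iff₀ (by positivity)]
    have h25 : (25 : ℝ) ≤ (2 * (j : ℝ) + 1) ^ 2 := by nlinarith
    have hpos : 0 ≤ (j : ℝ) * (T₀ * V ^ j) := by positivity
    calc (j : ℝ) * (T₀ * V ^ j) = (j : ℝ) * (T₀ / (25 * π)) * V ^ j * (π * 25) := by field_simp
      _ ≤ (j : ℝ) * (T₀ / (25 * π)) * V ^ j * (π * (2 * (j : ℝ) + 1) ^ 2) := by
          apply mul_le_mul_of_nonneg_left _ (by positivity)
          exact mul_le_mul_of_nonneg_left h25 hπ.le
  -- term 2: `s T^{2j} ≤ j V^j · s/2`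
  have h2 : s * T ^ (2 * j) ≤ (j : ℝ) * (s / 2) * V ^ j := by
    have hT2 : T ^ (2 * j) ≤ V ^ j := by
      rw [pow_mul]; exact pow_le_pow_left₀ (sq_nonneg T) (by rw [hV]; nlinarith) j
    have h3 := mul_le_mul_of_nonneg_left hT2 hs
    have h4 : s * V ^ j ≤ (j : ℝ) * (s / 2) * V ^ j := by
      have h5 : 0 ≤ s * V ^ j := mul_nonneg hs (pow_nonneg hV0.le j)
      nlinarith [h5, hj2]
    linarith
  -- term 3: `j W^{j−1}(T+¼)K ≤ j V^j · (T+¼)K/W`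
  have h3 : (j : ℝ) * W ^ (j - 1) * (T + 1 / 4) * (zetaZeroCount T : ℝ) ≤
      (j : ℝ) * ((T + 1 / 4) * (zetaZeroCount T : ℝ) / W) * V ^ j := by
    have e : W ^ (j - 1) = W ^ j / W := by
      rw [eq_div_iff hW0.ne', ← pow_succ]; congr 1; omega
    rw [e]
    have : (j : ℝ) * (W ^ j / W) * (T + 1 / 4) * (zetaZeroCount T : ℝ) = (j : ℝ) * ((T + 1 / 4) * (zetaZeroCount T : ℝ) / W) * W ^ j := by
      field_simp
    rw [this]
    exact mul_le_mul_of_nonneg_left hWVj (by positivity)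
  have e : (j : ℝ) * (T₀ / (25 * π) + s / 2 + (T + 1 / 4) * (zetaZeroCount T : ℝ) / W) * V ^ j =
      (j : ℝ) * (T₀ / (25 * π)) * V ^ j + (j : ℝ) * (s / 2) * V ^ j + (j : ℝ) * ((T + 1 / 4) * (zetaZeroCount T : ℝ) / W) * V ^ j := by
    ring
  rw [e]
  linarith

/-! ## The size hypotheses under `‖S_j‖ ≤ j·A·V^j` -/

/-- **Main-range size, counting form**: for `V·m < p₁`, `|(−1)^m Re h_m − p₁^m/m!| ≤ (p₁^m/m!)(exp(A(Vm/p₁)²/(1 − Vm/p₁)) − 1)`.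
[this track, ATTEMPT-16 §5 Lemma D1 (i)–(ii)] -/
theorem abs_profileCoeff_sub_le_counting {b T A V : ℝ} (hA : 0 ≤ A) (hV : 0 ≤ V)
    (hp : 0 < (dodgerPowerSum b T 1).re)
    (hS : ∀ j, 2 ≤ j → ‖dodgerPowerSum b T j‖ ≤ (j : ℝ) * A * V ^ j)
    {m : ℕ} (hm : V * m < (dodgerPowerSum b T 1).re) :
    |(-1) ^ m * (PowerSeries.coeff m (dodgerH b T)).re - (dodgerPowerSum b T 1).re ^ m / (m.factorial : ℝ)| ≤
      (dodgerPowerSum b T 1).re ^ m / (m.factorial : ℝ) *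
        (Real.exp (A * (V * (m : ℝ) / (dodgerPowerSum b T 1).re) ^ 2 / (1 - V * (m : ℝ) / (dodgerPowerSum b T 1).re)) - 1) := by
  obtain ⟨hr0, hrec, hconv⟩ := dodgerH_cumulant_form b T
  have h := norm_sub_le_of_counting (S := dodgerPowerSum b T) (r := fun n => PowerSeries.coeff n (dodgerR b T))
    (h := fun n => PowerSeries.coeff n (dodgerH b T)) hp hA hV hr0 hrec hS hconv hm
  refine le_trans ?_ h
  have e : (-1 : ℝ) ^ m * (PowerSeries.coeff m (dodgerH b T)).re - (dodgerPowerSum b T 1).re ^ m / (m.factorial : ℝ) =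
      (-1) ^ m * (PowerSeries.coeff m (dodgerH b T) -
        ((-(dodgerPowerSum b T 1).re : ℝ) : ℂ) ^ m / (m.factorial : ℂ)).re := by
    have hre : ((((-(dodgerPowerSum b T 1).re : ℝ) : ℂ) ^ m / (m.factorial : ℂ))).re =
        (-(dodgerPowerSum b T 1).re) ^ m / (m.factorial : ℝ) := by
      rw [← Complex.ofReal_pow, ← Complex.ofReal_natCast, ← Complex.ofReal_div, Complex.ofReal_re]
    rw [Complex.sub_re, hre, neg_pow (dodgerPowerSum b T 1).re, mul_sub]
    congr 1
    rw [mul_div_assoc', ← mul_assoc, ← mul_pow, show (-1 : ℝ) * -1 = 1 by norm_num, one_pow, one_mul]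
  rw [e, abs_mul, abs_pow, abs_neg, abs_one, one_pow, one_mul]
  exact Complex.abs_re_le_norm _

/-- **Tail size, counting form**: for every `m`, `|(−1)^m Re h_m| ≤ e^{p₁/(2V) + A/2}·(2V)^m` (the tail bound at `u = 1/(2V)`).
[this track, ATTEMPT-19 §2, §5] -/
theorem abs_profileCoeff_le_counting {b T A V : ℝ} (hA : 0 ≤ A) (hV : 0 < V)
    (hp : 0 ≤ (dodgerPowerSum b T 1).re)
    (hS : ∀ j, 2 ≤ j → ‖dodgerPowerSum b T j‖ ≤ (j : ℝ) * A * V ^ j) (m : ℕ) :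
    |(-1) ^ m * (PowerSeries.coeff m (dodgerH b T)).re| ≤
      Real.exp ((dodgerPowerSum b T 1).re / (2 * V) + A / 2) * (2 * V) ^ m := by
  obtain ⟨hr0, hrec, hconv⟩ := dodgerH_cumulant_form b T
  have hu : (0 : ℝ) < 1 / (2 * V) := by positivity
  have hVu : V * (1 / (2 * V)) < 1 := by
    rw [← mul_div_assoc, mul_one, div_lt_one (by positivity)]; linarith
  have h := norm_le_of_counting (S := dodgerPowerSum b T) (r := fun n => PowerSeries.coeff n (dodgerR b T))
    (h := fun n => PowerSeries.coeff n (dodgerH b T)) hp hA hV.le hr0 hrec hS hconv m hu hVu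
  rw [abs_mul, abs_pow, abs_neg, abs_one, one_pow, one_mul]
  refine (Complex.abs_re_le_norm _).trans (h.trans (le_of_eq ?_))
  have hVu2 : V * (1 / (2 * V)) = 1 / 2 := by field_simp
  rw [hVu2, show (1 / (2 * V)) ^ m = ((2 * V) ^ m)⁻¹ by rw [one_div, inv_pow], div_inv_eq_mul]
  congr 2
  field_simp
  norm_num

/-! ## Profile control under the counting bound -/

set_option maxHeartbeats 400000 in
/-- **ATTEMPT-16 Lemma D1 (profile control on the collar) under the counting cumulant bound.** See the module docstring.
[this track, ATTEMPT-16 §5 Lemma D1; ATTEMPT-19 §5; DODGER-STAGE2-PLAN §2] -/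
theorem re_dodger_edge_sub_ge_counting {b T δ A V : ℝ} (hb : 0 < b) (hA : 0 ≤ A) (hV : 0 < V)
    (hp : 0 < (dodgerPowerSum b T 1).re) (hδb : δ ≤ b)
    (hS : ∀ j, 2 ≤ j → ‖dodgerPowerSum b T j‖ ≤ (j : ℝ) * A * V ^ j)
    {N₁ N₂ : ℕ} (hN : N₁ ≤ N₂) (hVN : V * N₂ < (dodgerPowerSum b T 1).re)
    {X η lam ρ₁ ρ₂ τ₁ τ₂ : ℝ} (hX : (dodgerPowerSum b T 1).re * (2 * δ) ^ 2 ≤ X)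
    (hη : Real.exp (A * (V * (N₁ : ℝ) / (dodgerPowerSum b T 1).re) ^ 2 / (1 - V * (N₁ : ℝ) / (dodgerPowerSum b T 1).re)) - 1 ≤ η)
    (hlam : A * V ^ 2 * (N₂ : ℝ) / ((dodgerPowerSum b T 1).re ^ 2 * (1 - V * (N₂ : ℝ) / (dodgerPowerSum b T 1).re)) ≤ lam)
    (hρ₁ : Real.exp (3 + lam) * X / (4 * ((N₁ : ℝ) + 1) ^ 3) ≤ ρ₁) (hρ₁1 : ρ₁ < 1)
    (hρ₂ : Real.exp 2 * V * (2 * δ) ^ 2 / (2 * ((N₂ : ℝ) + 1) ^ 2) ≤ ρ₂) (hρ₂1 : ρ₂ < 1)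
    (hτ₁ : ρ₁ ^ (N₁ + 1) / (1 - ρ₁) ≤ τ₁)
    (hτ₂ : Real.exp ((dodgerPowerSum b T 1).re / (2 * V) + A / 2) * ρ₂ ^ (N₂ + 1) / (1 - ρ₂) ≤ τ₂)
    {σ : ℝ} (hσ0 : 0 ≤ σ) (hσ : σ ≤ 2 * δ) :
    (1 - η - 3 * τ₁ - τ₂) *
        ((1 / (2 * b)) * ((∏ k ∈ Finset.range (zetaZeroCount T), (latticeFreq b (k + 1)) ^ 2) /
          ∏ ρ ∈ zerosBetween 0 T, ‖dodgerNode ρ‖ ^ (2 * (riemannZetaZeroOrder ρ).toNat))) *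
        dodgerPhi ((dodgerPowerSum b T 1).re * σ ^ 2) ≤
      (cutoffCosPoly b (zetaZeroCount T) (dodgerCoeff b T (zetaZeroCount T)) (b - σ)).re := by
  set p := (dodgerPowerSum b T 1).re with hpdef
  set E : ℝ := Real.exp (p / (2 * V) + A / 2) with hEdef
  set g : ℕ → ℝ := fun m => A * (V * (m : ℝ) / p) ^ 2 / |1 - V * (m : ℝ) / p| with hgdef
  set cR := (∏ k ∈ Finset.range (zetaZeroCount T), (latticeFreq b (k + 1)) ^ 2) /
      ∏ ρ ∈ zerosBetween 0 T, ‖dodgerNode ρ‖ ^ (2 * (riemannZetaZeroOrder ρ).toNat) with hcR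
  have hcR0 : 0 < cR := by
    have h1 : 0 < ∏ k ∈ Finset.range (zetaZeroCount T), (latticeFreq b (k + 1)) ^ 2 :=
      Finset.prod_pos fun k _ => by unfold latticeFreq; positivity
    exact div_pos h1 (prod_norm_dodgerNode_pow_pos T)
  have hσb : σ ≤ 2 * b := by linarith
  -- in range `m ≤ N₂`: `V m / p < 1`
  have hin : ∀ m : ℕ, m ≤ N₂ → V * (m : ℝ) / p < 1 := by
    intro m hm
    rw [div_lt_one hp]
    exact lt_of_le_of_lt (mul_le_mul_of_nonneg_left (by exact_mod_cast hm) hV.le) hVN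
  have hgin : ∀ m : ℕ, m ≤ N₂ → g m = A * (V * (m : ℝ) / p) ^ 2 / (1 - V * (m : ℝ) / p) := by
    intro m hm
    simp only [hgdef]
    rw [abs_of_pos (by linarith [hin m hm])]
  -- the size hypotheses
  have H1 : ∀ m : ℕ, m ≤ N₂ → |(-1) ^ m * (PowerSeries.coeff m (dodgerH b T)).re - p ^ m / (m.factorial : ℝ)| ≤
      p ^ m / (m.factorial : ℝ) * (Real.exp (g m) - 1) := by
    intro m hm
    rw [hgin m hm]
    have hm' : V * (m : ℝ) < p := by have := hin m hm; rwa [div_lt_one hp] at this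
    exact abs_profileCoeff_sub_le_counting hA hV.le hp hS hm'
  have H2 : ∀ m : ℕ, N₂ < m → |(-1) ^ m * (PowerSeries.coeff m (dodgerH b T)).re| ≤ E * (2 * V) ^ m :=
    fun m _ => abs_profileCoeff_le_counting hA hV hp.le hS m
  -- the majorant conditions
  have hg0 : ∀ m : ℕ, 0 ≤ g m := fun m => by simp only [hgdef]; positivity
  have hgmono : ∀ m : ℕ, m ≤ N₁ → g m ≤ g N₁ := by
    intro m hm
    rw [hgin m (hm.trans hN), hgin N₁ hN]
    have h1 : V * (m : ℝ) / p ≤ V * (N₁ : ℝ) / p :=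
      div_le_div_of_nonneg_right (mul_le_mul_of_nonneg_left (by exact_mod_cast hm) hV.le) hp.le
    have h0 : 0 ≤ V * (m : ℝ) / p := by positivity
    have hN1 := hin N₁ hN
    have hnum : A * (V * (m : ℝ) / p) ^ 2 ≤ A * (V * (N₁ : ℝ) / p) ^ 2 :=
      mul_le_mul_of_nonneg_left (pow_le_pow_left₀ h0 h1 2) hA
    calc A * (V * (m : ℝ) / p) ^ 2 / (1 - V * (m : ℝ) / p) ≤ A * (V * (N₁ : ℝ) / p) ^ 2 / (1 - V * (m : ℝ) / p) :=
          div_le_div_of_nonneg_right hnum (by linarith [hin m (hm.trans hN)])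
      _ ≤ A * (V * (N₁ : ℝ) / p) ^ 2 / (1 - V * (N₁ : ℝ) / p) :=
          div_le_div_of_nonneg_left (by positivity) (by linarith) (by linarith)
  have hd2 : 0 < 1 - V * (N₂ : ℝ) / p := by linarith [hin N₂ le_rfl]
  have hlam0 : 0 ≤ lam := by
    refine le_trans ?_ hlam
    exact div_nonneg (by positivity) (mul_nonneg (sq_nonneg _) hd2.le)
  have hglam : ∀ m : ℕ, N₁ < m → m ≤ N₂ → g m ≤ lam * m := by
    intro m _ hm2
    rw [hgin m hm2]
    have hm0 : (0 : ℝ) ≤ m := Nat.cast_nonneg m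
    have hmN : (m : ℝ) ≤ N₂ := by exact_mod_cast hm2
    have hdm : 1 - V * (N₂ : ℝ) / p ≤ 1 - V * (m : ℝ) / p := by
      have : V * (m : ℝ) / p ≤ V * (N₂ : ℝ) / p :=
        div_le_div_of_nonneg_right (mul_le_mul_of_nonneg_left hmN hV.le) hp.le
      linarith
    -- `g m = (A V² m/(p²(1 − Vm/p)))·m ≤ (A V² N₂/(p²(1 − VN₂/p)))·m ≤ lam·m`
    have e : A * (V * (m : ℝ) / p) ^ 2 / (1 - V * (m : ℝ) / p) =
        A * V ^ 2 * (m : ℝ) / (p ^ 2 * (1 - V * (m : ℝ) / p)) * m := by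
      field_simp
    rw [e]
    refine mul_le_mul_of_nonneg_right (le_trans ?_ hlam) hm0
    have hdmpos : 0 < 1 - V * (m : ℝ) / p := lt_of_lt_of_le hd2 hdm
    rw [div_le_div_iff₀ (mul_pos (pow_pos hp 2) hdmpos) (mul_pos (pow_pos hp 2) hd2)]
    have h1 : A * V ^ 2 * (m : ℝ) ≤ A * V ^ 2 * (N₂ : ℝ) := mul_le_mul_of_nonneg_left hmN (by positivity)
    have h2 : 0 ≤ A * V ^ 2 * (N₂ : ℝ) := by positivity
    have h3 : 0 ≤ p ^ 2 * (1 - V * (N₂ : ℝ) / p) := mul_nonneg (sq_nonneg _) hd2.le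
    calc A * V ^ 2 * (m : ℝ) * (p ^ 2 * (1 - V * (N₂ : ℝ) / p)) ≤ A * V ^ 2 * (N₂ : ℝ) * (p ^ 2 * (1 - V * (N₂ : ℝ) / p)) :=
          mul_le_mul_of_nonneg_right h1 h3
      _ ≤ A * V ^ 2 * (N₂ : ℝ) * (p ^ 2 * (1 - V * (m : ℝ) / p)) :=
          mul_le_mul_of_nonneg_left (mul_le_mul_of_nonneg_left hdm (by positivity)) h2
  have hη' : Real.exp (g N₁) - 1 ≤ η := by rw [hgin N₁ hN]; exact hη
  -- the two sums
  have hSum := hasSum_dodger_profile hb T hσ0 hσb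
  have hΦ : HasSum (fun m : ℕ => (p * σ ^ 2) ^ m / ((m.factorial : ℝ) * ((2 * m).factorial : ℝ))) (dodgerPhi (p * σ ^ 2)) :=
    hasSum_dodgerPhi (p * σ ^ 2)
  have hσX : p * σ ^ 2 ≤ X := by
    refine le_trans ?_ hX
    have : σ ^ 2 ≤ (2 * δ) ^ 2 := pow_le_pow_left₀ hσ0 hσ (2 : ℕ)
    exact mul_le_mul_of_nonneg_left this hp.le
  have hρ₂' : Real.exp 2 * V * σ ^ 2 / (2 * ((N₂ : ℝ) + 1) ^ 2) ≤ ρ₂ := by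
    refine le_trans ?_ hρ₂
    have : σ ^ 2 ≤ (2 * δ) ^ 2 := pow_le_pow_left₀ hσ0 hσ (2 : ℕ)
    gcongr
  have key := profile_lower_bound_of_majorant (b := fun m => (-1) ^ m * (PowerSeries.coeff m (dodgerH b T)).re) (g := g)
    hp hV.le (Real.exp_pos _).le hN H1 H2 hg0 hgmono hlam0 hglam hσ0 hσX hη' hρ₁ hρ₁1 hρ₂' hρ₂1 hτ₁ hτ₂
    (S := 2 * b / cR * (cutoffCosPoly b (zetaZeroCount T) (dodgerCoeff b T (zetaZeroCount T)) (b - σ)).re)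
    (hSum.congr_fun fun m => by ring) hΦ
  -- rescale by `c_∞/(2b) > 0`
  have hfac : 0 < 1 / (2 * b) * cR := by positivity
  have e : (cutoffCosPoly b (zetaZeroCount T) (dodgerCoeff b T (zetaZeroCount T)) (b - σ)).re =
      (1 / (2 * b) * cR) * (2 * b / cR * (cutoffCosPoly b (zetaZeroCount T) (dodgerCoeff b T (zetaZeroCount T)) (b - σ)).re) := by
    field_simp
  rw [e]
  calc (1 - η - 3 * τ₁ - τ₂) * (1 / (2 * b) * cR) * dodgerPhi (p * σ ^ 2)
      = (1 / (2 * b) * cR) * ((1 - η - 3 * τ₁ - τ₂) * dodgerPhi (p * σ ^ 2)) := by ring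
    _ ≤ (1 / (2 * b) * cR) * (2 * b / cR * (cutoffCosPoly b (zetaZeroCount T) (dodgerCoeff b T (zetaZeroCount T)) (b - σ)).re) :=
        mul_le_mul_of_nonneg_left key hfac.le

end Summit.RiemannHypothesis.RiemannHypothesis.Theorems.Handoff

end
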